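import Literature.NumberTheory.LFunctions.Zhang2022.KnifeEdgeLenZDegreeMinors
import Literature.NumberTheory.LFunctions.Zhang2022.KnifeEdgeLenZDegreePsiOn
import HarnessLib

/-!
# Negative lane of `PsiGradedTablesClosePoly` (h2′, stmt-Parity-22438): no closing ON a class below the Gershgorin threshold

Y. Zhang, *Discrete mean estimates and the Landau–Siegel zero*, arXiv:2211.02515v1 [Zhang2022LandauSiegel] — an
unrefereed manuscript under adjudication; nothing here asserts any of its claims and nothing here is a statement about
Landau–Siegel zeros. Desk lemmas of the §G referee (ls-ref-1, F1-THRESHOLD v1 7274a716c55e539b), (A)-free, pure algebra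
plus Zhang's `𝔅 ≥ 0` (`mainTermForm_nonneg_of_isH1`):

* `two_re_cross_ge` — the cross term `2Re(z·conj(w·u)) ≥ −(|z|² + |w|²)·|u|`;
* `gradedQuadForm_ge_rows` — **Gershgorin lower bound** for the graded form:
  `Σ_i (𝔅_i − R_i)|s_i|² ≤ gradedQuadForm`, row masses `R₀ = |X₁(f,g₁)| + |X₂(f,g₂)|`, `R₁ = |X₁(f,g₁)| + |Y₁(g₁,g₂)|`,
  `R₂ = |X₂(f,g₂)| + |Y₁(g₁,g₂)|`;
* `exists_row_excess_of_gradedClosesOn` — **closing ON a class forces a live row:** `GradedClosesOn 𝒞 X₁ Y₁ X₂` ⇒ at some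
  in-class design whose three pairs lie in `𝒞`, ONE row's off-diagonal mass exceeds its diagonal `𝔅` (the minimum-mass
  sentence of the desk's threshold table, in Gershgorin form);
* `not_gradedClosesOn_of_rows_dominant`, `not_gradedClosesOn_of_darkOn` — contrapositives: tables dominated row-wise by
  the diagonal (in particular tables DARK on `𝒞`) close on NO design inside `𝒞` (class-relative form of
  `not_gradedCloses_allDark`);
* `gradedClosesOn_of_minor01/02/12` — the SUFFICIENT side ON the class (rev 2): one 2×2 minor violated at a pair of `𝒞`,
  `𝔅(f)·𝔅(g) < |X(f,g)|²`, with ANY class-compatible idle third leg, gives `GradedClosesOn 𝒞 X₁ Y₁ X₂` (class-relative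
  `gradedCloses_of_minor··`, whose idle leg `g⋆` need not lie in `𝒞`). Together: row threshold (necessary) and minor
  threshold (sufficient) bracket the closing ON a class.

Bearing on h2′ (`…Theses.ZDegreeToeplitzBand.PsiGradedTablesClosePoly`, whose consequent is `GradedClosesOn 𝒞 X₁ Y₁ X₂` for
the tables ON a sub-unit poly class `𝒞`): its sign test can only pass at a design where some long cell of `𝒞` carries
mass above the row threshold — with the displayed below-wrap values (all long cells `0`) it fails. No Theses statement is
asserted; no new `Prop`; standard axioms.
-/

noncomputable section

open Complex Real ComplexConjugate Matrix

namespace Summit.Parity.GeneralizedHardyLittlewood.Theorems.PsiGradedTablesClosePoly.Negative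

open Literature.NumberTheory.LFunctions.Zhang2022 Literature.NumberTheory.LFunctions.Zhang2022.KnifeEdge
open Literature.NumberTheory.LFunctions.Zhang2022.Repair Literature.NumberTheory.LFunctions.Zhang2022.Skeleton

/-! ### Part 1 — the cross-term bound and the Gershgorin lower bound (pure algebra) -/

/-- The cross term of the graded form is bounded below by the arithmetic–geometric mean:
`−(|z|² + |w|²)·|u| ≤ 2Re(z·conj(w·u))`. [folklore] -/
theorem two_re_cross_ge (z w u : ℂ) : -((‖z‖ ^ 2 + ‖w‖ ^ 2) * ‖u‖) ≤ 2 * (z * conj (w * u)).re := by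
  have h1 : |(z * conj (w * u)).re| ≤ ‖z * conj (w * u)‖ := Complex.abs_re_le_norm _
  have h2 : ‖z * conj (w * u)‖ = ‖z‖ * (‖w‖ * ‖u‖) := by simp
  have h3 := (abs_le.mp h1).1
  rw [h2] at h3
  nlinarith [mul_nonneg (sq_nonneg (‖z‖ - ‖w‖)) (norm_nonneg u), norm_nonneg z, norm_nonneg w, norm_nonneg u]

variable {X₁ Y₁ X₂ : PairFunctional} {f f' g₁ g₁' g₂ g₂' : ℝ → ℂ} {𝒞 : PairClass}

/-- **Gershgorin lower bound for the graded quadratic form (proved, (A)-free):** with the row masses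
`R₀ = |X₁(f,g₁)| + |X₂(f,g₂)|`, `R₁ = |X₁(f,g₁)| + |Y₁(g₁,g₂)|`, `R₂ = |X₂(f,g₂)| + |Y₁(g₁,g₂)|`,
`Σ_i (𝔅_i − R_i)|s_i|² ≤ Re Σ_{a,b} s_a conj(s_b) M_{ab}`. [cite: Zhang2022LandauSiegel, §2 (2.16)–(2.17)] -/
theorem gradedQuadForm_ge_rows (X₁ Y₁ X₂ : PairFunctional) (f f' g₁ g₁' g₂ g₂' : ℝ → ℂ) (s : Fin 3 → ℂ) :
    (mainTermForm f f' - (‖X₁ f f' g₁ g₁'‖ + ‖X₂ f f' g₂ g₂'‖)) * ‖s 0‖ ^ 2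
      + (mainTermForm g₁ g₁' - (‖X₁ f f' g₁ g₁'‖ + ‖Y₁ g₁ g₁' g₂ g₂'‖)) * ‖s 1‖ ^ 2
      + (mainTermForm g₂ g₂' - (‖X₂ f f' g₂ g₂'‖ + ‖Y₁ g₁ g₁' g₂ g₂'‖)) * ‖s 2‖ ^ 2
      ≤ gradedQuadForm (gradedMainMatrix X₁ Y₁ X₂ f f' g₁ g₁' g₂ g₂') s := by
  rw [gradedQuadForm_eq]
  have h01 := two_re_cross_ge (s 0) (s 1) (X₁ f f' g₁ g₁')
  have h12 := two_re_cross_ge (s 1) (s 2) (Y₁ g₁ g₁' g₂ g₂')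
  have h02 := two_re_cross_ge (s 0) (s 2) (X₂ f f' g₂ g₂')
  nlinarith [h01, h12, h02]

/-! ### Part 2 — closing ON a class forces a live row; dark or row-dominated tables close nowhere in the class -/

/-- **Closing inside `𝒞` forces a live row (proved, (A)-free):** if the graded form goes negative at an in-class design
whose three pairs lie in `𝒞`, then at that design ONE row's off-diagonal table mass exceeds its diagonal main-term form:
`𝔅(f) < |X₁(f,g₁)| + |X₂(f,g₂)|` or `𝔅(g₁) < |X₁(f,g₁)| + |Y₁(g₁,g₂)|` or `𝔅(g₂) < |X₂(f,g₂)| + |Y₁(g₁,g₂)|` — the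
minimum table mass a closing witness needs (Gershgorin form). [cite: Zhang2022LandauSiegel, §2 (2.16)–(2.17), §7 Prop 7.1 (7.2)] -/
theorem exists_row_excess_of_gradedClosesOn (h : GradedClosesOn 𝒞 X₁ Y₁ X₂) :
    ∃ f f' g₁ g₁' g₂ g₂' : ℝ → ℂ, InClassPiece f f' ∧ InClassPiece g₁ g₁' ∧ InClassPiece g₂ g₂' ∧
      𝒞 f f' g₁ g₁' ∧ 𝒞 f f' g₂ g₂' ∧ 𝒞 g₁ g₁' g₂ g₂' ∧
      (mainTermForm f f' < ‖X₁ f f' g₁ g₁'‖ + ‖X₂ f f' g₂ g₂'‖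
        ∨ mainTermForm g₁ g₁' < ‖X₁ f f' g₁ g₁'‖ + ‖Y₁ g₁ g₁' g₂ g₂'‖
        ∨ mainTermForm g₂ g₂' < ‖X₂ f f' g₂ g₂'‖ + ‖Y₁ g₁ g₁' g₂ g₂'‖) := by
  obtain ⟨f, f', g₁, g₁', g₂, g₂', s, hf, hg₁, hg₂, h01, h02, h12, hneg⟩ := h
  refine ⟨f, f', g₁, g₁', g₂, g₂', hf, hg₁, hg₂, h01, h02, h12, ?_⟩
  by_contra hcon
  push Not at hcon
  obtain ⟨h0, h1, h2⟩ := hcon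
  have hG := gradedQuadForm_ge_rows X₁ Y₁ X₂ f f' g₁ g₁' g₂ g₂' s
  nlinarith [mul_nonneg (sub_nonneg.mpr h0) (sq_nonneg ‖s 0‖), mul_nonneg (sub_nonneg.mpr h1) (sq_nonneg ‖s 1‖),
    mul_nonneg (sub_nonneg.mpr h2) (sq_nonneg ‖s 2‖)]

/-- **Row-dominated tables close on no design inside `𝒞` (proved):** if at every in-class design with pairs in `𝒞` each
row's off-diagonal mass is at most its diagonal `𝔅`, then `¬ GradedClosesOn 𝒞 X₁ Y₁ X₂`. [cite: Zhang2022LandauSiegel, §2 (2.16)–(2.17)] -/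
theorem not_gradedClosesOn_of_rows_dominant
    (h : ∀ f f' g₁ g₁' g₂ g₂' : ℝ → ℂ, InClassPiece f f' → InClassPiece g₁ g₁' → InClassPiece g₂ g₂' →
      𝒞 f f' g₁ g₁' → 𝒞 f f' g₂ g₂' → 𝒞 g₁ g₁' g₂ g₂' →
      ‖X₁ f f' g₁ g₁'‖ + ‖X₂ f f' g₂ g₂'‖ ≤ mainTermForm f f' ∧
        ‖X₁ f f' g₁ g₁'‖ + ‖Y₁ g₁ g₁' g₂ g₂'‖ ≤ mainTermForm g₁ g₁' ∧
        ‖X₂ f f' g₂ g₂'‖ + ‖Y₁ g₁ g₁' g₂ g₂'‖ ≤ mainTermForm g₂ g₂') :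
    ¬ GradedClosesOn 𝒞 X₁ Y₁ X₂ := by
  intro hc
  obtain ⟨f, f', g₁, g₁', g₂, g₂', hf, hg₁, hg₂, h01, h02, h12, hrow⟩ := exists_row_excess_of_gradedClosesOn hc
  obtain ⟨h0, h1, h2⟩ := h f f' g₁ g₁' g₂ g₂' hf hg₁ hg₂ h01 h02 h12
  rcases hrow with h | h | h <;> linarith

/-- **Tables DARK on `𝒞` close on no design inside `𝒞` (proved; class-relative `not_gradedCloses_allDark`):** if
`X₁ = Y₁ = X₂ = 0` on every in-class pair of `𝒞`, then `¬ GradedClosesOn 𝒞 X₁ Y₁ X₂` — the diagonal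
`(𝔅(f), 𝔅(g₁), 𝔅(g₂))` is PSD by `𝔅 ≥ 0`. (Desk reading: the below-wrap display of the long cells, all `0`, can pass no
sign test.) [cite: Zhang2022LandauSiegel, §2 (2.16), §7 Prop 7.1] -/
theorem not_gradedClosesOn_of_darkOn
    (h : ∀ f f' g g' : ℝ → ℂ, InClassPiece f f' → InClassPiece g g' → 𝒞 f f' g g' →
      X₁ f f' g g' = 0 ∧ Y₁ f f' g g' = 0 ∧ X₂ f f' g g' = 0) :
    ¬ GradedClosesOn 𝒞 X₁ Y₁ X₂ := by
  refine not_gradedClosesOn_of_rows_dominant fun f f' g₁ g₁' g₂ g₂' hf hg₁ hg₂ h01 h02 h12 => ?_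
  obtain ⟨hx1, -, -⟩ := h f f' g₁ g₁' hf hg₁ h01
  obtain ⟨-, -, hx2⟩ := h f f' g₂ g₂' hf hg₂ h02
  obtain ⟨-, hy1, -⟩ := h g₁ g₁' g₂ g₂' hg₁ hg₂ h12
  have hBf := mainTermForm_nonneg_of_isH1 hf.kinked.isH1
  have hB1 := mainTermForm_nonneg_of_isH1 hg₁.kinked.isH1
  have hB2 := mainTermForm_nonneg_of_isH1 hg₂.kinked.isH1
  simp only [hx1, hx2, hy1, norm_zero, add_zero]
  exact ⟨hBf, hB1, hB2⟩

/-! ### Part 3 — the sufficient side ON the class: one violated 2×2 minor with a class-compatible idle leg closes -/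

/-- The generic 2×2 step (pure algebra; private copy of the tree's `KnifeEdgeLenZDegreeMinors` step): for `a ≥ 0`, real `b`
and `a·b < |z|²` the binary form `a|u|² + b|v|² + 2Re(u·conj(v·z))` takes a negative value. [folklore] -/
private theorem binary_form_neg_on {a b : ℝ} (ha : 0 ≤ a) {z : ℂ} (h : a * b < ‖z‖ ^ 2) :
    ∃ u v : ℂ, a * ‖u‖ ^ 2 + b * ‖v‖ ^ 2 + 2 * (u * conj (v * z)).re < 0 := by
  by_cases hz0 : z = 0
  · subst hz0
    have hb : b < 0 := by
      rw [norm_zero] at h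
      by_contra hb
      have : 0 ≤ a * b := mul_nonneg ha (not_lt.mp hb)
      linarith
    exact ⟨0, 1, by simpa using hb⟩
  have hz : 0 < ‖z‖ ^ 2 := by positivity
  have key : ∀ r : ℝ, a * ‖(-(r : ℂ) * z)‖ ^ 2 + b * ‖(1 : ℂ)‖ ^ 2 + 2 * ((-(r : ℂ) * z) * conj ((1 : ℂ) * z)).re =
      a * r ^ 2 * ‖z‖ ^ 2 + b - 2 * r * ‖z‖ ^ 2 := by
    intro r
    have hre : ((-(r : ℂ) * z) * conj ((1 : ℂ) * z)).re = -(r * ‖z‖ ^ 2) := by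
      rw [one_mul, mul_assoc, Complex.mul_conj', neg_mul, Complex.neg_re]
      norm_cast
    rw [hre, norm_mul, norm_neg, Complex.norm_real, Real.norm_eq_abs, mul_pow, sq_abs, norm_one]
    ring
  rcases eq_or_lt_of_le ha with rfl | ha'
  · refine ⟨-(((|b| + 1) / ‖z‖ ^ 2 : ℝ) : ℂ) * z, 1, ?_⟩
    rw [key]
    have : 2 * ((|b| + 1) / ‖z‖ ^ 2) * ‖z‖ ^ 2 = 2 * (|b| + 1) := by field_simp
    rw [this]
    simp only [zero_mul, zero_add]
    linarith [le_abs_self b, abs_nonneg b]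
  · refine ⟨-(((1 / a : ℝ)) : ℂ) * z, 1, ?_⟩
    rw [key]
    have e : a * (1 / a) ^ 2 * ‖z‖ ^ 2 + b - 2 * (1 / a) * ‖z‖ ^ 2 = b - ‖z‖ ^ 2 / a := by field_simp; ring
    rw [e]
    have hb : b < ‖z‖ ^ 2 / a := by rw [lt_div_iff₀ ha']; linarith [mul_comm a b]
    linarith

/-- **One violated minor on the NEW table closes ON the class (proved):** in-class pieces `f, g₁, g₂` with all three pairs in
`𝒞` and `𝔅(f)·𝔅(g₂) < |X₂(f,g₂)|²` ⇒ `GradedClosesOn 𝒞 X₁ Y₁ X₂` — amplitudes `(u, 0, v)`, the middle leg `g₁` idle (any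
class-compatible piece), whatever `X₁, Y₁` are. [cite: Zhang2022LandauSiegel, §2 (2.16), §7 Prop 7.1 (7.2)] -/
theorem gradedClosesOn_of_minor02 (hf : InClassPiece f f') (hg₁ : InClassPiece g₁ g₁') (hg₂ : InClassPiece g₂ g₂')
    (h01 : 𝒞 f f' g₁ g₁') (h02 : 𝒞 f f' g₂ g₂') (h12 : 𝒞 g₁ g₁' g₂ g₂')
    (h : mainTermForm f f' * mainTermForm g₂ g₂' < ‖X₂ f f' g₂ g₂'‖ ^ 2) : GradedClosesOn 𝒞 X₁ Y₁ X₂ := by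
  obtain ⟨u, v, huv⟩ := binary_form_neg_on (mainTermForm_nonneg_of_isH1 hf.kinked.isH1) h
  refine ⟨f, f', g₁, g₁', g₂, g₂', ![u, 0, v], hf, hg₁, hg₂, h01, h02, h12, ?_⟩
  rw [gradedQuadForm_eq]
  simp only [Matrix.cons_val_zero, Matrix.cons_val_one, Matrix.head_cons, Matrix.cons_val_two, Matrix.tail_cons,
    norm_zero, zero_mul, mul_zero, map_zero, Complex.zero_re, add_zero, map_mul]
  simpa [map_mul] using huv

/-- **One violated minor on the degree-1 cross table closes ON the class (proved):** `𝔅(f)·𝔅(g₁) < |X₁(f,g₁)|²` with a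
class-compatible idle leg `g₂` ⇒ `GradedClosesOn 𝒞 X₁ Y₁ X₂` (amplitudes `(u, v, 0)`). [cite: Zhang2022LandauSiegel, §2 (2.16), §7 Prop 7.1 (7.2)] -/
theorem gradedClosesOn_of_minor01 (hf : InClassPiece f f') (hg₁ : InClassPiece g₁ g₁') (hg₂ : InClassPiece g₂ g₂')
    (h01 : 𝒞 f f' g₁ g₁') (h02 : 𝒞 f f' g₂ g₂') (h12 : 𝒞 g₁ g₁' g₂ g₂')
    (h : mainTermForm f f' * mainTermForm g₁ g₁' < ‖X₁ f f' g₁ g₁'‖ ^ 2) : GradedClosesOn 𝒞 X₁ Y₁ X₂ := by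
  obtain ⟨u, v, huv⟩ := binary_form_neg_on (mainTermForm_nonneg_of_isH1 hf.kinked.isH1) h
  refine ⟨f, f', g₁, g₁', g₂, g₂', ![u, v, 0], hf, hg₁, hg₂, h01, h02, h12, ?_⟩
  rw [gradedQuadForm_eq]
  simp only [Matrix.cons_val_zero, Matrix.cons_val_one, Matrix.head_cons, Matrix.cons_val_two, Matrix.tail_cons,
    norm_zero, zero_mul, mul_zero, map_zero, Complex.zero_re, add_zero, map_mul]
  simpa [map_mul] using huv

/-- **One violated minor on the dual table closes ON the class (proved):** `𝔅(g₁)·𝔅(g₂) < |Y₁(g₁,g₂)|²` with a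
class-compatible idle leg `f` ⇒ `GradedClosesOn 𝒞 X₁ Y₁ X₂` (amplitudes `(0, u, v)`). [cite: Zhang2022LandauSiegel, §2 (2.16)–(2.17), §7 Prop 7.1 (7.2)] -/
theorem gradedClosesOn_of_minor12 (hf : InClassPiece f f') (hg₁ : InClassPiece g₁ g₁') (hg₂ : InClassPiece g₂ g₂')
    (h01 : 𝒞 f f' g₁ g₁') (h02 : 𝒞 f f' g₂ g₂') (h12 : 𝒞 g₁ g₁' g₂ g₂')
    (h : mainTermForm g₁ g₁' * mainTermForm g₂ g₂' < ‖Y₁ g₁ g₁' g₂ g₂'‖ ^ 2) : GradedClosesOn 𝒞 X₁ Y₁ X₂ := by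
  obtain ⟨u, v, huv⟩ := binary_form_neg_on (mainTermForm_nonneg_of_isH1 hg₁.kinked.isH1) h
  refine ⟨f, f', g₁, g₁', g₂, g₂', ![0, u, v], hf, hg₁, hg₂, h01, h02, h12, ?_⟩
  rw [gradedQuadForm_eq]
  simp only [Matrix.cons_val_zero, Matrix.cons_val_one, Matrix.head_cons, Matrix.cons_val_two, Matrix.tail_cons,
    norm_zero, zero_mul, mul_zero, Complex.zero_re, add_zero, map_mul]
  simpa [map_mul] using huv

end Summit.Parity.GeneralizedHardyLittlewood.Theorems.PsiGradedTablesClosePoly.Negative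

end
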